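/-
Copyright: derived here (Resolution Observatory cell `pub-rosobs`, carver gen 60). AI-written Lean; AI review is
weaker than expert review.  Support bookkeeping behind engine 1's LEMMA XL ("integrated LL", THEOREM-F-eng1-g40 §4b;
CARVER-NOTES-eng1-g40 **T78**) for the cell's POLYNOMIAL weighted-centre model `W(f)`: the layers of a polynomial under
a substitution `X_i ↦ X_i + T_i` — the endomorphism analogue of `WeightedCentreDerivationLayers`.
Instrument — NOT a resolution theorem and NOT a statement about the invariant of [AbramovichTemkinWlodarczyk2024].
-/
import Mathlib.RingTheory.MvPolynomial.WeightedHomogeneous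
import Mathlib.Algebra.MvPolynomial.Derivation
import Mathlib.Algebra.MvPolynomial.PDeriv
import Mathlib.Algebra.Polynomial.AlgebraMap
import Mathlib.Algebra.Polynomial.Eval.Coeff
import HarnessLib

/-!
# Layers of a polynomial under the substitution `X_i ↦ X_i + T_i` (first-order Taylor = a derivation)

Uniform value line: INSTRUMENT — kernel-checked support bookkeeping for engine 1's LEMMA XL (THEOREM-F-eng1-g40 §4b:
"LEMMA LL's proof never uses that `D` is a derivation, only that it is additive and that `X := id + (…)` is
multiplicative"; the `C`-degree-`(d_h − 1)` layer of `X(G_h) − G_h` is `Σ_V T_V·∂_V P_h + Σ_β ε_C^β·(X(r_{h,β}) − r_{h,β})`,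
"one factor replaced by `T` in a monomial of `P_h`, or none in a monomial of `ℛ_h`; lower layers cannot reach") in the
cell's polynomial weighted-centre model `W(f)`; NOT a resolution theorem, NOT a statement about the
Abramovich–Temkin–Włodarczyk invariant, NOT summit progress, and NOT a proof of LEMMA XL / LEMMA K themselves (the pin
map and its constant left inverse live in the LL files); AI-written Lean, AI review is weaker than expert review.

## Content (notes ↔ this file)

`MvPolynomial σ R` over a commutative ring `R`, a family `T : σ → MvPolynomial σ R` ("`T_V := X(ε_V) − ε_V`").

* `paramShift T : F ↦ F(X + t·T) ∈ R[X_σ][t]` (the one-parameter version; `t ↦ 1` gives the substitution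
  `aeval (X + T)`: `eval_one_paramShift`).  `coeff_paramShift_zero`: `[t⁰] = F`.  **`coeff_paramShift_one`:
  `[t¹] F(X + tT) = (Σ_i T_i ∂_i) F`** — the first-order Taylor term is the derivation `MvPolynomial.mkDerivation R T`
  ("`Σ_V T_V·∂_V`"), proved from additivity and multiplicativity of `paramShift` alone (Leibniz for `[t¹]`,
  `coeff_paramShift_one_mul`).
* GRADING (`isWeightedHomogeneous_coeff_paramShift`): for group-valued weights `w : σ → M` and `T_i` homogeneous of
  weight `w_i − ρ` ("`X` graded of degree `−ρ`"), `[t^j] F(X + tT)` is homogeneous of weight `m − j•ρ` when `F` is of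
  weight `m`.  With the `C`-DEGREE `N` (`N = 1` on the class `C`, `0` off `C`; cast to `ℤ`, `ρ = 1`; hypothesis
  "`T_V` is `C`-free for `V ∈ C` and `T_i = 0` off `C`" = `T_i` of `N`-weight `N_i − 1`):
  `[t^j]` of an `N`-degree-`d` layer has `N`-degree `d − j` (`isWeightedHomogeneous_nat_coeff_paramShift`) and vanishes
  for `j > d` (`coeff_paramShift_eq_zero_of_lt`).
* **LAYERS OF THE SUBSTITUTION** (`weightedHomogeneousComponent_aeval_add`): for `F` of `N`-degree `d` and `k ≤ d`,
  `comp_k (F(X + T)) = [t^{d−k}] F(X + tT)`; in particular `comp_d (F(X + T)) = F`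
  (`weightedHomogeneousComponent_aeval_add_top`), **`comp_{d−1}(F(X + T)) = (Σ_V T_V ∂_V) F`**
  (`weightedHomogeneousComponent_aeval_add_sub_one`: "one factor replaced by `T`") and `comp_k (F(X + T)) = 0` for
  `k > d` (`weightedHomogeneousComponent_aeval_add_eq_zero`: "cannot reach").
* XL's LINEAR-ALGEBRA STEP (`eq_apply_of_constLeftInverse`): a constant left inverse `λ` of the (constant) pin matrix
  `κ` commutes with any `k`-linear `E` ("`X − id`"), so `(κ ⊗ id)T = −(id ⊗ E)ℛ` gives `T_V = E(m_V)`, `m := −(λ ⊗ id)ℛ`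
  independent of `E`; and then `X(ε_V − m_V) = ε_V − m_V` (`apply_sub_eq_self_of_shift`).
* DEGREE-ZERO GRADED ENDOMORPHISMS (`isWeightedHomogeneous_aeval_graded`, `weightedHomogeneousComponent_aeval_graded`):
  if every `f_i` is `w`-homogeneous of weight `w_i` then `aeval f` preserves weights and commutes with `comp_m` — the
  "light action" `X_L` of XL (`X` fixes the `C`-slots and maps light slots to `C`-free polynomials), so that
  `X = X_C ∘ X_L` with `X_C` the `C`-translation and `comp_{d−1}(X G) = (Σ_V T_V∂_V)(X_L G_d) + X_L(G_{d−1})` for `G` of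
  `N`-degree `≤ d` (`weightedHomogeneousComponent_comp_sub_one`).

References: [Lang2002] Ch. IV §1 (polynomials in `X + tT`, Taylor's formula), Ch. XIX §3 (derivations of polynomial
rings, `D = Σ D(X_i)∂_i`), Ch. XIII §3 (matrices and linear maps); context [AbramovichTemkinWlodarczyk2024] §5.  Statements in this form and the
formalisation: ours / derived here (CARVER-NOTES-eng1-g40 T78).
-/

namespace Literature.AlgebraicGeometry.Resolution.WeightedBlowup

namespace EndomorphismLayers

open MvPolynomial

variable {σ R : Type*} [CommRing R]

/-! ## The one-parameter shift `F ↦ F(X + t·T)` -/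

/-- `F ↦ F(X + t·T) ∈ R[X_σ][t]` for a family of polynomials `T` (ours; `WeightedCentreInvariantDirection.lineShift` is
the case of constant `T`). [cite: Lang2002, Ch. IV §1] -/
noncomputable def paramShift (T : σ → MvPolynomial σ R) : MvPolynomial σ R →ₐ[R] Polynomial (MvPolynomial σ R) :=
  aeval fun i => Polynomial.C (X i) + Polynomial.X * Polynomial.C (T i)

/-- On a variable (ours, bookkeeping). [cite: Lang2002, Ch. IV §1] -/
@[simp] theorem paramShift_X (T : σ → MvPolynomial σ R) (i : σ) :
    paramShift T (X i) = Polynomial.C (X i) + Polynomial.X * Polynomial.C (T i) := by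
  simp [paramShift]

/-- On a constant (ours, bookkeeping). [cite: Lang2002, Ch. IV §1] -/
@[simp] theorem paramShift_C (T : σ → MvPolynomial σ R) (a : R) :
    paramShift T (C a) = Polynomial.C (C a) := by
  simp [paramShift, Polynomial.algebraMap_apply, MvPolynomial.algebraMap_eq]

/-- `[t⁰] F(X + tT) = F` (derived here). [cite: Lang2002, Ch. IV §1] -/
theorem coeff_paramShift_zero (T : σ → MvPolynomial σ R) (F : MvPolynomial σ R) : (paramShift T F).coeff 0 = F := by
  induction F using MvPolynomial.induction_on with
  | C a => rw [paramShift_C, Polynomial.coeff_C_zero]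
  | add p q hp hq => rw [map_add, Polynomial.coeff_add, hp, hq]
  | mul_X p i hp =>
    rw [map_mul, Polynomial.mul_coeff_zero, hp, paramShift_X, Polynomial.coeff_add, Polynomial.coeff_C_zero,
      Polynomial.coeff_X_mul_zero, add_zero]

/-- Leibniz for `[t¹]`: `[t¹](FG)(X + tT) = F·[t¹]G(X + tT) + G·[t¹]F(X + tT)` — uses only that `paramShift` is
multiplicative and `≡ id (mod t)` (derived here). [cite: Lang2002, Ch. IV §1] -/
theorem coeff_paramShift_one_mul (T : σ → MvPolynomial σ R) (F G : MvPolynomial σ R) :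
    (paramShift T (F * G)).coeff 1 = F * (paramShift T G).coeff 1 + G * (paramShift T F).coeff 1 := by
  rw [map_mul, Polynomial.coeff_mul, Finset.Nat.sum_antidiagonal_eq_sum_range_succ_mk, Finset.sum_range_succ,
    Finset.sum_range_succ, Finset.sum_range_zero, zero_add, Nat.sub_zero, Nat.sub_self, coeff_paramShift_zero,
    coeff_paramShift_zero]
  ring

/-- **The first-order Taylor term is the derivation `Σ_i T_i ∂_i`**: `[t¹] F(X + tT) = mkDerivation R T F`
(derived here; both sides are additive, satisfy Leibniz and agree on the variables).
[cite: Lang2002, Ch. XIX §3] -/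
theorem coeff_paramShift_one (T : σ → MvPolynomial σ R) (F : MvPolynomial σ R) :
    (paramShift T F).coeff 1 = mkDerivation R T F := by
  induction F using MvPolynomial.induction_on with
  | C a => rw [paramShift_C, Polynomial.coeff_C, if_neg one_ne_zero, derivation_C]
  | add p q hp hq => rw [map_add, Polynomial.coeff_add, hp, hq, map_add]
  | mul_X p i hp =>
    rw [coeff_paramShift_one_mul, hp, Derivation.leibniz, mkDerivation_X, paramShift_X, Polynomial.coeff_add,
      Polynomial.coeff_C, if_neg one_ne_zero, zero_add, Polynomial.coeff_X_mul, Polynomial.coeff_C_zero, smul_eq_mul,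
      smul_eq_mul]

/-- In coordinates over a finite index type: `mkDerivation R T F = Σ_i T_i · ∂_i F`, so
`[t¹] F(X + tT) = Σ_i T_i · ∂_i F` (derived here; cf. `WeightedBlowup.derivation_apply_eq_sum_pderiv_mul` of
`WeightedCentreConstantField`). [cite: Lang2002, Ch. XIX §3] -/
theorem coeff_paramShift_one_eq_sum [Fintype σ] [DecidableEq σ] (T : σ → MvPolynomial σ R) (F : MvPolynomial σ R) :
    (paramShift T F).coeff 1 = ∑ i, T i * pderiv i F := by
  rw [coeff_paramShift_one]
  induction F using MvPolynomial.induction_on with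
  | C a => simp only [derivation_C, mul_zero, Finset.sum_const_zero]
  | add p q hp hq => simp only [map_add, hp, hq, mul_add, Finset.sum_add_distrib]
  | mul_X p i hp =>
    have h2 : ∀ j, T j * pderiv j (p * X i) = X i * (T j * pderiv j p) + p * (T j * pderiv j (X i)) := by
      intro j
      rw [Derivation.leibniz, smul_eq_mul, smul_eq_mul]
      ring
    have hXi : ∑ j, T j * pderiv j (X i : MvPolynomial σ R) = T i := by
      rw [Finset.sum_eq_single i (fun j _ hj => by rw [pderiv_X_of_ne (Ne.symm hj), mul_zero])
        (fun h => absurd (Finset.mem_univ i) h), pderiv_X_self, mul_one]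
    rw [Derivation.leibniz, mkDerivation_X, hp, smul_eq_mul, smul_eq_mul]
    simp only [h2, Finset.sum_add_distrib, ← Finset.mul_sum]
    rw [hXi]
    ring

/-- `t ↦ 1`: `F(X + tT)|_{t=1} = F(X + T)` (derived here). [cite: Lang2002, Ch. IV §1] -/
theorem eval_one_paramShift (T : σ → MvPolynomial σ R) (F : MvPolynomial σ R) :
    (paramShift T F).eval 1 = aeval (fun i => X i + T i) F := by
  induction F using MvPolynomial.induction_on with
  | C a => rw [paramShift_C, Polynomial.eval_C, aeval_C, algebraMap_eq]
  | add p q hp hq => rw [map_add, Polynomial.eval_add, hp, hq, map_add]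
  | mul_X p i hp =>
    rw [map_mul, Polynomial.eval_mul, hp, map_mul, aeval_X, paramShift_X, Polynomial.eval_add, Polynomial.eval_C,
      Polynomial.eval_mul, Polynomial.eval_X, Polynomial.eval_C, one_mul]

/-- `F(X + T) = Σ_j [t^j] F(X + tT)` over any range beyond the `t`-degree (derived here). [cite: Lang2002, Ch. IV §1] -/
theorem aeval_add_eq_sum_coeff (T : σ → MvPolynomial σ R) (F : MvPolynomial σ R) {n : ℕ}
    (hn : (paramShift T F).natDegree < n) :
    aeval (fun i => X i + T i) F = ∑ j ∈ Finset.range n, (paramShift T F).coeff j := by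
  rw [← eval_one_paramShift, Polynomial.eval_eq_sum_range' hn]
  simp only [one_pow, mul_one]

/-! ## Grading: `[t^j] F(X + tT)` has weight `m − j•ρ` -/

section Graded

variable {M : Type*} [AddCommGroup M] {w : σ → M} {ρ : M} {T : σ → MvPolynomial σ R}

/-- Products (derived here): if all `[t^j]F` have weight `m_F − jρ` and all `[t^j]G` weight `m_G − jρ`, then all
`[t^j](FG)` have weight `m_F + m_G − jρ`. [cite: Lang2002, Ch. IV §1] -/
theorem coeffGraded_mul {F G : MvPolynomial σ R} {mF mG : M}
    (hF : ∀ j, IsWeightedHomogeneous w ((paramShift T F).coeff j) (mF - j • ρ))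
    (hG : ∀ j, IsWeightedHomogeneous w ((paramShift T G).coeff j) (mG - j • ρ)) (j : ℕ) :
    IsWeightedHomogeneous w ((paramShift T (F * G)).coeff j) (mF + mG - j • ρ) := by
  rw [map_mul, Polynomial.coeff_mul]
  refine IsWeightedHomogeneous.sum _ _ _ fun x hx => ?_
  have hx' : x.1 + x.2 = j := Finset.mem_antidiagonal.mp hx
  have hdeg : mF + mG - j • ρ = (mF - x.1 • ρ) + (mG - x.2 • ρ) := by
    rw [← hx', add_smul]
    abel
  rw [hdeg]
  exact (hF x.1).mul (hG x.2)

/-- `1` (ours, bookkeeping). [cite: Lang2002, Ch. IV §1] -/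
theorem coeffGraded_one (j : ℕ) :
    IsWeightedHomogeneous w ((paramShift T (1 : MvPolynomial σ R)).coeff j) (0 - j • ρ) := by
  rw [map_one, Polynomial.coeff_one]
  split_ifs with h
  · subst h
    rw [zero_smul, sub_zero]
    exact isWeightedHomogeneous_one R w
  · exact isWeightedHomogeneous_zero R w _

/-- Constants (ours, bookkeeping). [cite: Lang2002, Ch. IV §1] -/
theorem coeffGraded_C (a : R) (j : ℕ) :
    IsWeightedHomogeneous w ((paramShift T (C a)).coeff j) (0 - j • ρ) := by
  rw [paramShift_C, Polynomial.coeff_C]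
  split_ifs with h
  · subst h
    rw [zero_smul, sub_zero]
    exact isWeightedHomogeneous_C w a
  · exact isWeightedHomogeneous_zero R w _

/-- Variables (derived here): `[t⁰](X_i + tT_i) = X_i` of weight `w_i`, `[t¹] = T_i` of weight `w_i − ρ`.
[cite: Lang2002, Ch. IV §1] -/
theorem coeffGraded_X {i : σ} (hT : IsWeightedHomogeneous w (T i) (w i - ρ)) (j : ℕ) :
    IsWeightedHomogeneous w ((paramShift T (X i)).coeff j) (w i - j • ρ) := by
  rw [paramShift_X, Polynomial.coeff_add, Polynomial.coeff_C]
  rcases j with _ | j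
  · rw [if_pos rfl, Polynomial.coeff_X_mul_zero, add_zero, zero_smul, sub_zero]
    exact isWeightedHomogeneous_X R w i
  · rw [if_neg (Nat.succ_ne_zero j), zero_add, Polynomial.coeff_X_mul, Polynomial.coeff_C]
    split_ifs with h
    · subst h
      rw [zero_add, one_smul]
      exact hT
    · exact isWeightedHomogeneous_zero R w _

/-- Powers (derived here). [cite: Lang2002, Ch. IV §1] -/
theorem coeffGraded_pow {F : MvPolynomial σ R} {m : M}
    (hF : ∀ j, IsWeightedHomogeneous w ((paramShift T F).coeff j) (m - j • ρ)) (n : ℕ) (j : ℕ) :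
    IsWeightedHomogeneous w ((paramShift T (F ^ n)).coeff j) (n • m - j • ρ) := by
  induction n generalizing j with
  | zero =>
    rw [pow_zero, zero_smul]
    exact coeffGraded_one j
  | succ n ih =>
    rw [pow_succ, succ_nsmul]
    exact coeffGraded_mul ih hF j

/-- Finite products (derived here). [cite: Lang2002, Ch. IV §1] -/
theorem coeffGraded_prod {ι : Type*} (s : Finset ι) (F : ι → MvPolynomial σ R) (m : ι → M)
    (h : ∀ i ∈ s, ∀ j, IsWeightedHomogeneous w ((paramShift T (F i)).coeff j) (m i - j • ρ)) (j : ℕ) :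
    IsWeightedHomogeneous w ((paramShift T (∏ i ∈ s, F i)).coeff j) ((∑ i ∈ s, m i) - j • ρ) := by
  classical
  induction s using Finset.induction_on generalizing j with
  | empty =>
    rw [Finset.prod_empty, Finset.sum_empty]
    exact coeffGraded_one j
  | insert i s hi ih =>
    rw [Finset.prod_insert hi, Finset.sum_insert hi]
    exact coeffGraded_mul (h i (Finset.mem_insert_self _ _))
      (fun k => ih (fun l hl => h l (Finset.mem_insert_of_mem hl)) k) j

/-- Monomials (derived here): `[t^j]` of `a·X^s` evaluated at `X + tT` has weight `|s|_w − jρ`.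
[cite: Lang2002, Ch. IV §1] -/
theorem coeffGraded_monomial (hT : ∀ i, IsWeightedHomogeneous w (T i) (w i - ρ)) (s : σ →₀ ℕ) (a : R) (j : ℕ) :
    IsWeightedHomogeneous w ((paramShift T (monomial s a)).coeff j) (Finsupp.weight w s - j • ρ) := by
  rw [monomial_eq, Finsupp.weight_apply, Finsupp.prod, Finsupp.sum]
  have h := coeffGraded_mul (coeffGraded_C (w := w) (ρ := ρ) (T := T) a)
    (coeffGraded_prod s.support (fun i => X i ^ s i) (fun i => s i • w i)
      (fun i _ k => coeffGraded_pow (coeffGraded_X (hT i)) (s i) k)) j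
  rwa [zero_add] at h

/-- **GRADING** (derived here): if every `T_i` is `w`-homogeneous of weight `w_i − ρ` ("`X(ε_V) − ε_V` of weight
`w_V − ρ`": a graded substitution of degree `−ρ`) and `F` is of weight `m`, then `[t^j] F(X + tT)` is of weight
`m − j•ρ`. [cite: Lang2002, Ch. IV §1] -/
theorem isWeightedHomogeneous_coeff_paramShift (hT : ∀ i, IsWeightedHomogeneous w (T i) (w i - ρ))
    {F : MvPolynomial σ R} {m : M} (hF : IsWeightedHomogeneous w F m) (j : ℕ) :
    IsWeightedHomogeneous w ((paramShift T F).coeff j) (m - j • ρ) := by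
  classical
  rw [F.as_sum, map_sum, Polynomial.finsetSum_coeff]
  refine IsWeightedHomogeneous.sum _ _ _ fun s hs => ?_
  have hws : Finsupp.weight w s = m := hF (mem_support_iff.mp hs)
  rw [← hws]
  exact coeffGraded_monomial hT s _ j

end Graded

/-! ## `ℕ`-valued weights (the `C`-degree `N`): layers of `F(X + T)` -/

section NatGraded

variable {N : σ → ℕ} {T : σ → MvPolynomial σ R}

/-- Cast bookkeeping (ours). [cite: Lang2002, Ch. IV §1] -/
theorem weight_intCast (N : σ → ℕ) (d : σ →₀ ℕ) :
    Finsupp.weight (fun i => (N i : ℤ)) d = ((Finsupp.weight N d : ℕ) : ℤ) := by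
  simp only [Finsupp.weight_apply, Finsupp.sum, smul_eq_mul, nsmul_eq_mul, Nat.cast_sum, Nat.cast_mul]

/-- Cast bookkeeping (ours): `N`-homogeneous of degree `m` iff `(N : ℤ)`-homogeneous of degree `m`.
[cite: Lang2002, Ch. IV §1] -/
theorem isWeightedHomogeneous_intCast_iff (N : σ → ℕ) (F : MvPolynomial σ R) (m : ℕ) :
    IsWeightedHomogeneous (fun i => (N i : ℤ)) F (m : ℤ) ↔ IsWeightedHomogeneous N F m := by
  simp only [IsWeightedHomogeneous, weight_intCast, Nat.cast_inj]

/-- A polynomial `(N : ℤ)`-homogeneous of NEGATIVE degree is `0` (ours). [cite: Lang2002, Ch. IV §1] -/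
theorem eq_zero_of_isWeightedHomogeneous_neg (N : σ → ℕ) {F : MvPolynomial σ R} {z : ℤ}
    (hF : IsWeightedHomogeneous (fun i => (N i : ℤ)) F z) (hz : z < 0) : F = 0 := by
  ext d
  rw [coeff_zero]
  by_contra h
  have h' := hF h
  rw [weight_intCast] at h'
  omega

/-- With `T_i` of `N`-weight `N_i − 1` (for the `C`-degree: `T_V` is `C`-free for `V ∈ C`, `T_i = 0` off `C`) and `F`
of `N`-degree `d`: `[t^j] F(X + tT)` has `N`-degree `d − j` for `j ≤ d` (derived here). [cite: Lang2002, Ch. IV §1] -/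
theorem isWeightedHomogeneous_nat_coeff_paramShift
    (hT : ∀ i, IsWeightedHomogeneous (fun i => (N i : ℤ)) (T i) ((N i : ℤ) - 1))
    {F : MvPolynomial σ R} {d : ℕ} (hF : IsWeightedHomogeneous N F d) {j : ℕ} (hj : j ≤ d) :
    IsWeightedHomogeneous N ((paramShift T F).coeff j) (d - j) := by
  have h := isWeightedHomogeneous_coeff_paramShift (ρ := (1 : ℤ)) hT
    ((isWeightedHomogeneous_intCast_iff N F d).mpr hF) j
  rw [nsmul_one, ← Nat.cast_sub hj] at h
  exact (isWeightedHomogeneous_intCast_iff N _ _).mp h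

/-- … and `[t^j] F(X + tT) = 0` for `j > d` ("lower layers cannot reach"; derived here). [cite: Lang2002, Ch. IV §1] -/
theorem coeff_paramShift_eq_zero_of_lt
    (hT : ∀ i, IsWeightedHomogeneous (fun i => (N i : ℤ)) (T i) ((N i : ℤ) - 1))
    {F : MvPolynomial σ R} {d : ℕ} (hF : IsWeightedHomogeneous N F d) {j : ℕ} (hj : d < j) :
    (paramShift T F).coeff j = 0 := by
  have h := isWeightedHomogeneous_coeff_paramShift (ρ := (1 : ℤ)) hT
    ((isWeightedHomogeneous_intCast_iff N F d).mpr hF) j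
  rw [nsmul_one] at h
  exact eq_zero_of_isWeightedHomogeneous_neg N h (by omega)

/-- **LAYERS OF THE SUBSTITUTION** (derived here): for `F` of `N`-degree `d` and `k ≤ d`,
`comp_k (F(X + T)) = [t^{d−k}] F(X + tT)`. [cite: Lang2002, Ch. IV §1] -/
theorem weightedHomogeneousComponent_aeval_add
    (hT : ∀ i, IsWeightedHomogeneous (fun i => (N i : ℤ)) (T i) ((N i : ℤ) - 1))
    {F : MvPolynomial σ R} {d : ℕ} (hF : IsWeightedHomogeneous N F d) {k : ℕ} (hk : k ≤ d) :
    weightedHomogeneousComponent N k (aeval (fun i => X i + T i) F) = (paramShift T F).coeff (d - k) := by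
  classical
  rw [aeval_add_eq_sum_coeff T F (show (paramShift T F).natDegree < (paramShift T F).natDegree + d + 1 by omega),
    map_sum, Finset.sum_eq_single (d - k)]
  · have h := isWeightedHomogeneous_nat_coeff_paramShift hT hF (Nat.sub_le d k)
    rw [Nat.sub_sub_self hk] at h
    exact h.weightedHomogeneousComponent_same
  · intro j _ hj
    rcases le_or_gt j d with hjd | hjd
    · exact (isWeightedHomogeneous_nat_coeff_paramShift hT hF hjd).weightedHomogeneousComponent_ne k (by omega)
    · rw [coeff_paramShift_eq_zero_of_lt hT hF hjd, map_zero]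
  · intro h
    exact absurd (Finset.mem_range.mpr (by omega)) h

/-- Top layer: `comp_d (F(X + T)) = F` ("none replaced"; derived here). [cite: Lang2002, Ch. IV §1] -/
theorem weightedHomogeneousComponent_aeval_add_top
    (hT : ∀ i, IsWeightedHomogeneous (fun i => (N i : ℤ)) (T i) ((N i : ℤ) - 1))
    {F : MvPolynomial σ R} {d : ℕ} (hF : IsWeightedHomogeneous N F d) :
    weightedHomogeneousComponent N d (aeval (fun i => X i + T i) F) = F := by
  rw [weightedHomogeneousComponent_aeval_add hT hF le_rfl, Nat.sub_self, coeff_paramShift_zero]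

/-- **Next layer: `comp_{d−1} (F(X + T)) = (Σ_V T_V ∂_V) F`** ("one factor replaced by `T`"; derived here, `1 ≤ d`).
[cite: Lang2002, Ch. IV §1] -/
theorem weightedHomogeneousComponent_aeval_add_sub_one
    (hT : ∀ i, IsWeightedHomogeneous (fun i => (N i : ℤ)) (T i) ((N i : ℤ) - 1))
    {F : MvPolynomial σ R} {d : ℕ} (hF : IsWeightedHomogeneous N F d) (hd : 1 ≤ d) :
    weightedHomogeneousComponent N (d - 1) (aeval (fun i => X i + T i) F) = mkDerivation R T F := by
  rw [weightedHomogeneousComponent_aeval_add hT hF (Nat.sub_le d 1), Nat.sub_sub_self hd, coeff_paramShift_one]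

/-- Layers above `d` vanish: `comp_k (F(X + T)) = 0` for `k > d` (derived here). [cite: Lang2002, Ch. IV §1] -/
theorem weightedHomogeneousComponent_aeval_add_eq_zero
    (hT : ∀ i, IsWeightedHomogeneous (fun i => (N i : ℤ)) (T i) ((N i : ℤ) - 1))
    {F : MvPolynomial σ R} {d : ℕ} (hF : IsWeightedHomogeneous N F d) {k : ℕ} (hk : d < k) :
    weightedHomogeneousComponent N k (aeval (fun i => X i + T i) F) = 0 := by
  classical
  rw [aeval_add_eq_sum_coeff T F (Nat.lt_succ_self _), map_sum]
  refine Finset.sum_eq_zero fun j _ => ?_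
  rcases le_or_gt j d with hjd | hjd
  · exact (isWeightedHomogeneous_nat_coeff_paramShift hT hF hjd).weightedHomogeneousComponent_ne k (by omega)
  · rw [coeff_paramShift_eq_zero_of_lt hT hF hjd, map_zero]

end NatGraded

/-! ## Degree-zero graded endomorphisms commute with taking components (the light action `X_L`) -/

section DegreeZero

variable {M : Type*} [AddCommMonoid M] {w : σ → M} {f : σ → MvPolynomial σ R}

/-- If every `f_i` is `w`-homogeneous of weight `w_i`, `aeval f` preserves `w`-homogeneity and weight (derived here).
[cite: Lang2002, Ch. IV §1] -/
theorem isWeightedHomogeneous_aeval_graded (hf : ∀ i, IsWeightedHomogeneous w (f i) (w i))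
    {F : MvPolynomial σ R} {m : M} (hF : IsWeightedHomogeneous w F m) : IsWeightedHomogeneous w (aeval f F) m := by
  classical
  rw [F.as_sum, map_sum]
  refine IsWeightedHomogeneous.sum _ _ _ fun s hs => ?_
  have hws : Finsupp.weight w s = m := hF (mem_support_iff.mp hs)
  rw [aeval_monomial, ← hws, Finsupp.weight_apply, Finsupp.prod, Finsupp.sum, algebraMap_eq]
  exact (IsWeightedHomogeneous.prod _ _ _ fun i _ => (hf i).pow (s i)).C_mul _

/-- **A degree-zero graded endomorphism commutes with `comp_n`** (derived here): `comp_n (aeval f G) = aeval f (comp_n G)`.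
[cite: Lang2002, Ch. IV §1] -/
theorem weightedHomogeneousComponent_aeval_graded (hf : ∀ i, IsWeightedHomogeneous w (f i) (w i))
    (G : MvPolynomial σ R) (n : M) :
    weightedHomogeneousComponent w n (aeval f G) = aeval f (weightedHomogeneousComponent w n G) := by
  classical
  have hfin := weightedHomogeneousComponent_finsupp (w := w) G
  have hG : G = ∑ m ∈ hfin.toFinset, weightedHomogeneousComponent w m G := by
    conv_lhs => rw [← sum_weightedHomogeneousComponent w G]
    exact finsum_eq_sum _ hfin
  have hhom : ∀ m, IsWeightedHomogeneous w (aeval f (weightedHomogeneousComponent w m G)) m := fun m =>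
    isWeightedHomogeneous_aeval_graded hf (weightedHomogeneousComponent_isWeightedHomogeneous m G)
  conv_lhs => rw [hG, map_sum, map_sum]
  rw [Finset.sum_eq_single n (fun m _ hmn => (hhom m).weightedHomogeneousComponent_ne n hmn.symm) fun hn => ?_]
  · exact (hhom n).weightedHomogeneousComponent_same
  · have h0 : weightedHomogeneousComponent w n G = 0 := by
      simpa [Set.Finite.mem_toFinset, Function.mem_support] using hn
    rw [h0, map_zero, map_zero]

end DegreeZero

/-! ## The XL layer identity: `X = X_C ∘ X_L` -/

section Composite

variable {N : σ → ℕ} {T f : σ → MvPolynomial σ R}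

/-- **The `C`-degree-`(d − 1)` layer of `X(G)` for `X = X_C ∘ X_L`** (derived here; `X_C = aeval (X + T)` the
`C`-translation with `T_i` of `N`-weight `N_i − 1`, `X_L = aeval f` with `f_i` of `N`-weight `N_i`, `G` of `N`-degree
`≤ d`, `1 ≤ d`): `comp_{d−1}(X_C (X_L G)) = (Σ_V T_V ∂_V)(X_L (comp_d G)) + X_L (comp_{d−1} G)` — "`Σ_V T_V·∂_V P_h`
plus `Σ_β ε_C^β·X(r_{h,β})`; lower layers cannot reach". [cite: Lang2002, Ch. IV §1] -/
theorem weightedHomogeneousComponent_comp_sub_one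
    (hT : ∀ i, IsWeightedHomogeneous (fun i => (N i : ℤ)) (T i) ((N i : ℤ) - 1))
    (hf : ∀ i, IsWeightedHomogeneous N (f i) (N i)) {G : MvPolynomial σ R} {d : ℕ} (hd : 1 ≤ d)
    (hG : ∀ j, d < j → weightedHomogeneousComponent N j G = 0) :
    weightedHomogeneousComponent N (d - 1) (aeval (fun i => X i + T i) (aeval f G))
      = mkDerivation R T (aeval f (weightedHomogeneousComponent N d G))
        + aeval f (weightedHomogeneousComponent N (d - 1) G) := by
  classical
  have hfin := weightedHomogeneousComponent_finsupp (w := N) G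
  have hGs : G = ∑ m ∈ hfin.toFinset, weightedHomogeneousComponent N m G := by
    conv_lhs => rw [← sum_weightedHomogeneousComponent N G]
    exact finsum_eq_sum _ hfin
  have hhom : ∀ m, IsWeightedHomogeneous N (aeval f (weightedHomogeneousComponent N m G)) m := fun m =>
    isWeightedHomogeneous_aeval_graded hf (weightedHomogeneousComponent_isWeightedHomogeneous m G)
  have hdd : d ≠ d - 1 := by omega
  -- the contribution of the layer `m` to `comp_{d-1}` of the image
  have hterm : ∀ m, weightedHomogeneousComponent N (d - 1)
      (aeval (fun i => X i + T i) (aeval f (weightedHomogeneousComponent N m G)))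
        = (if m = d then mkDerivation R T (aeval f (weightedHomogeneousComponent N d G)) else 0)
          + (if m = d - 1 then aeval f (weightedHomogeneousComponent N (d - 1) G) else 0) := by
    intro m
    by_cases hmd : m = d
    · rw [hmd, if_pos rfl, if_neg hdd, add_zero, weightedHomogeneousComponent_aeval_add_sub_one hT (hhom d) hd]
    · rw [if_neg hmd, zero_add]
      by_cases hmd1 : m = d - 1
      · rw [hmd1, if_pos rfl, weightedHomogeneousComponent_aeval_add_top hT (hhom _)]
      · rw [if_neg hmd1]
        rcases lt_or_gt_of_ne hmd with hlt | hgt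
        · exact weightedHomogeneousComponent_aeval_add_eq_zero hT (hhom m) (by omega)
        · rw [hG m hgt, map_zero, map_zero, map_zero]
  have hS : ∀ m, m ∉ hfin.toFinset → weightedHomogeneousComponent N m G = 0 := fun m hm => by
    simpa [Set.Finite.mem_toFinset, Function.mem_support] using hm
  conv_lhs => rw [hGs, map_sum, map_sum, map_sum]
  simp only [hterm, Finset.sum_add_distrib, Finset.sum_ite_eq']
  congr 1
  · split_ifs with h
    · rfl
    · rw [hS d h, map_zero, map_zero]
  · split_ifs with h
    · rfl
    · rw [hS _ h, map_zero]

end Composite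

/-! ## XL's linear-algebra step: a constant left inverse commutes with `X − id` -/

section ConstantLeftInverse

variable {k A : Type*} [CommRing k] [AddCommGroup A] [Module k A] {ιC ιB : Type*} [Fintype ιC] [Fintype ιB]
  [DecidableEq ιC]

/-- **XL's one new point** ("`λ ⊗ id` commutes with `id ⊗ (X − id)`", THEOREM-F-eng1-g40 §4b; derived here, plain
linear algebra): if the constant matrix `κ` ("the pin map `Κ_C` in coordinates") has a constant left inverse `λ`
(`λκ = 1`, LEMMA K's output), `E` is any `k`-linear map ("`X − id` on `k[LIGHT][σ]`") and
`Σ_V κ_{βV}·T_V = −E(ℛ_β)` for every `β` ("`(Κ_C ⊗ id)(T) = −(id ⊗ (X − id))(ℛ)`"), then `T_V = E(m_V)` with the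
`E`-INDEPENDENT `m_V := −Σ_β λ_{Vβ}·ℛ_β` ("`m := −(λ ⊗ id)(ℛ)`, the same `m` as in LEMMA LL").  NOT LEMMA XL itself (the
pin map, LEMMA K and the layer bookkeeping above are its other inputs). [cite: Lang2002, Ch. XIII §3] -/
theorem eq_apply_of_constLeftInverse (κ : Matrix ιB ιC k) (lam : Matrix ιC ιB k) (hinv : lam * κ = 1)
    (E : A →ₗ[k] A) (T : ιC → A) (ℛ : ιB → A) (h : ∀ β, ∑ V, κ β V • T V = -E (ℛ β)) (V : ιC) :
    T V = E (-∑ β, lam V β • ℛ β) := by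
  rw [map_neg, map_sum, ← Finset.sum_neg_distrib]
  simp_rw [map_smul, ← smul_neg, ← h, Finset.smul_sum, smul_smul]
  rw [Finset.sum_comm]
  simp_rw [← Finset.sum_smul]
  have hδ : ∀ V', ∑ β, lam V β * κ β V' = (1 : Matrix ιC ιC k) V V' := fun V' => by
    rw [← hinv, Matrix.mul_apply]
  simp_rw [hδ, Matrix.one_apply, ite_smul, one_smul, zero_smul, Finset.sum_ite_eq, Finset.mem_univ, if_true]

/-- … hence the corrected generator is FIXED: if `X` is additive with `X(ε_V) = ε_V + T_V` and `T_V = X(m_V) − m_V`, then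
`X(ε_V − m_V) = ε_V − m_V` (ours, bookkeeping; `X` any additive map). [cite: Lang2002, Ch. XIII §3] -/
theorem apply_sub_eq_self_of_shift {B : Type*} [AddCommGroup B] (X : B →+ B) {ε m T : B} (hε : X ε = ε + T)
    (hT : T = X m - m) : X (ε - m) = ε - m := by
  rw [map_sub, hε, hT]
  abel

end ConstantLeftInverse

end EndomorphismLayers

end Literature.AlgebraicGeometry.Resolution.WeightedBlowup
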